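import Mathlib

/-!
# P5S4TransportBasic — relabellings of a finite point set: images of sets, conjugate groups, profiles, CM types

The first half of the kernel-checked combinatorial core of Theorem A of proofs/P5-Dim8Census-S4Equivariance-v1.md
(cell pub-hodge-repro0, seat p5). For a finite set `S` of points and a permutation `w` of `S`:

* `smulF t Δ` = the image `tΔ` of a finite set under a permutation, with `smulF_mul`, `card_smulF`, `smulF_inter`,
  `smulF_injective`, `smulF_ssubset_smulF`, `smulF_nonempty`, `smulF_inv_smulF`;
* `conj w T` = the conjugate subgroup `w T w⁻¹` (`mem_conj`, `conj_mul`) and THE COUNTING-UNIT STEP of Theorem B (ii),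
  `conj_conj_of_mem_normalizer`: if `w` normalises a subgroup `W` of relabellings, then for `u ∈ W` the conjugate
  by `w` of `u T u⁻¹` is the conjugate of `w T w⁻¹` by `w u w⁻¹ ∈ W` — so conjugation by `w` is well defined on
  `W`-conjugacy classes;
* `conjF w T` = the conjugate `w T w⁻¹` of a finite SET of permutations (`cjE w` = conjugation as an embedding;
  `mem_conjF`, `conjF_mem`, `card_conjF`, `mem_map_cjE_iff_of_comm`);
* `prof blk Δ b` = the block profile `|Δ ∩ blk⁻¹(b)|` and `prof_transport`: a relabelling with `blk (w x) = σ (blk x)`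
  permutes the profile by `σ`;
* `IsCMType ι Φ` (`S = Φ ⊔ ιΦ`) and `isCMType_transport`: for `ι` commuting with `w`, `wΦ` is a CM type iff `Φ` is.

The second half (balanced / primitive sets, orbits, stabilisers, induced types, `H_Δ`, ι-flags, orbit sizes, rows) is
`P5S4Transport.lean`, which imports this file. Nothing about the census figures is certified anywhere.
-/

namespace HodgeRepro0.P5S4Transport

open Finset

variable {S : Type*}

/-- the image `t Δ` of a finite set under a permutation -/
def smulF (t : Equiv.Perm S) (Δ : Finset S) : Finset S := Δ.map t.toEmbedding

/-- membership in `t Δ`: `x ∈ tΔ ↔ t⁻¹ x ∈ Δ` -/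
theorem mem_smulF (t : Equiv.Perm S) (Δ : Finset S) (x : S) : x ∈ smulF t Δ ↔ t⁻¹ x ∈ Δ := by
  unfold smulF
  constructor
  · intro h
    obtain ⟨a, ha, rfl⟩ := Finset.mem_map.1 h
    simpa using ha
  · intro h
    exact Finset.mem_map.2 ⟨t⁻¹ x, h, by simp⟩

/-- `(tu)Δ = t(uΔ)` -/
theorem smulF_mul (t u : Equiv.Perm S) (Δ : Finset S) : smulF (t * u) Δ = smulF t (smulF u Δ) := by
  ext x
  simp only [mem_smulF, mul_inv_rev, Equiv.Perm.mul_apply]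

/-- `1 Δ = Δ` -/
theorem smulF_one (Δ : Finset S) : smulF 1 Δ = Δ := by
  ext x; simp [mem_smulF]

/-- `|tΔ| = |Δ|` -/
theorem card_smulF (t : Equiv.Perm S) (Δ : Finset S) : (smulF t Δ).card = Δ.card := Finset.card_map _

/-- `t(Δ ∩ Φ) = tΔ ∩ tΦ` -/
theorem smulF_inter [DecidableEq S] (t : Equiv.Perm S) (Δ Φ : Finset S) :
    smulF t (Δ ∩ Φ) = smulF t Δ ∩ smulF t Φ :=
  Finset.map_inter _ _

/-- `Δ ↦ tΔ` is injective -/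
theorem smulF_injective (t : Equiv.Perm S) : Function.Injective (smulF t) :=
  Finset.map_injective _

/-- `tA ⊂ tB ↔ A ⊂ B` -/
theorem smulF_ssubset_smulF (t : Equiv.Perm S) {A B : Finset S} : smulF t A ⊂ smulF t B ↔ A ⊂ B :=
  Finset.map_ssubset_map

/-- `tA` is nonempty iff `A` is -/
theorem smulF_nonempty (t : Equiv.Perm S) {A : Finset S} : (smulF t A).Nonempty ↔ A.Nonempty :=
  Finset.map_nonempty

/-- `w(w⁻¹Δ) = Δ` -/
theorem smulF_inv_smulF (w : Equiv.Perm S) (Δ : Finset S) : smulF w (smulF w⁻¹ Δ) = Δ := by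
  rw [← smulF_mul, mul_inv_cancel, smulF_one]

/-- `w⁻¹(wΔ) = Δ` -/
theorem inv_smulF_smulF (w : Equiv.Perm S) (Δ : Finset S) : smulF w⁻¹ (smulF w Δ) = Δ := by
  rw [← smulF_mul, inv_mul_cancel, smulF_one]

/-- the conjugate subgroup `w T w⁻¹` (subgroup version, for the counting-unit step) -/
def conj (w : Equiv.Perm S) (T : Subgroup (Equiv.Perm S)) : Subgroup (Equiv.Perm S) :=
  T.map (MulAut.conj w).toMonoidHom

/-- membership in the conjugate subgroup: `t' ∈ w T w⁻¹ ↔ w⁻¹ t' w ∈ T` -/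
theorem mem_conj {w : Equiv.Perm S} {T : Subgroup (Equiv.Perm S)} {t' : Equiv.Perm S} :
    t' ∈ conj w T ↔ w⁻¹ * t' * w ∈ T := by
  unfold conj
  rw [Subgroup.mem_map]
  constructor
  · rintro ⟨t, ht, rfl⟩
    have e : w⁻¹ * ((MulAut.conj w).toMonoidHom t) * w = t := by
      simp only [MulEquiv.coe_toMonoidHom, MulAut.conj_apply]; group
    rwa [e]
  · intro h
    refine ⟨w⁻¹ * t' * w, h, ?_⟩
    simp only [MulEquiv.coe_toMonoidHom, MulAut.conj_apply]; group

/-- `(ab) T (ab)⁻¹ = a (b T b⁻¹) a⁻¹` -/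
theorem conj_mul (a b : Equiv.Perm S) (T : Subgroup (Equiv.Perm S)) : conj (a * b) T = conj a (conj b T) := by
  ext t
  simp only [mem_conj, mul_inv_rev, mul_assoc]

/-- THE COUNTING-UNIT STEP (Theorem B (ii)): if `w` normalises `W`, then for `u ∈ W` the conjugate of
`u T u⁻¹` by `w` is a `W`-conjugate of `w T w⁻¹` (by the element `w u w⁻¹ ∈ W`). -/
theorem conj_conj_of_mem_normalizer (w : Equiv.Perm S) (W : Subgroup (Equiv.Perm S))
    (hw : ∀ u ∈ W, w * u * w⁻¹ ∈ W) (T : Subgroup (Equiv.Perm S)) {u : Equiv.Perm S} (hu : u ∈ W) :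
    ∃ v ∈ W, conj w (conj u T) = conj v (conj w T) := by
  refine ⟨w * u * w⁻¹, hw u hu, ?_⟩
  rw [← conj_mul, ← conj_mul]
  congr 1
  group

/-- conjugation `t ↦ w t w⁻¹` as an embedding -/
def cjE (w : Equiv.Perm S) : Equiv.Perm S ↪ Equiv.Perm S :=
  ⟨fun t => w * t * w⁻¹, fun a b h => by
    have := congrArg (fun x => w⁻¹ * x * w) h
    simp only at this
    have ea : w⁻¹ * (w * a * w⁻¹) * w = a := by group
    have eb : w⁻¹ * (w * b * w⁻¹) * w = b := by group
    rwa [ea, eb] at this⟩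

/-- `cjE w t = w t w⁻¹` -/
theorem cjE_apply (w t : Equiv.Perm S) : cjE w t = w * t * w⁻¹ := rfl

/-- the conjugate finite set of permutations `w T w⁻¹` -/
def conjF (w : Equiv.Perm S) (T : Finset (Equiv.Perm S)) : Finset (Equiv.Perm S) := T.map (cjE w)

/-- membership in the conjugate finite set: `t' ∈ w T w⁻¹ ↔ w⁻¹ t' w ∈ T` -/
theorem mem_conjF {w : Equiv.Perm S} {T : Finset (Equiv.Perm S)} {t' : Equiv.Perm S} :
    t' ∈ conjF w T ↔ w⁻¹ * t' * w ∈ T := by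
  unfold conjF
  rw [Finset.mem_map]
  constructor
  · rintro ⟨t, ht, rfl⟩
    have e : w⁻¹ * (cjE w t) * w = t := by rw [cjE_apply]; group
    rwa [e]
  · intro h
    refine ⟨w⁻¹ * t' * w, h, ?_⟩
    rw [cjE_apply]; group

/-- `t ∈ T → w t w⁻¹ ∈ w T w⁻¹` -/
theorem conjF_mem {w : Equiv.Perm S} {T : Finset (Equiv.Perm S)} {t : Equiv.Perm S} (ht : t ∈ T) :
    w * t * w⁻¹ ∈ conjF w T := by
  rw [mem_conjF]
  have e : w⁻¹ * (w * t * w⁻¹) * w = t := by group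
  rwa [e]

/-- `|w T w⁻¹| = |T|` -/
theorem card_conjF (w : Equiv.Perm S) (T : Finset (Equiv.Perm S)) : (conjF w T).card = T.card :=
  Finset.card_map _

/-- an element commuting with `w` is in `w X w⁻¹` iff it is in `X` -/
theorem mem_map_cjE_iff_of_comm {w ι : Equiv.Perm S} (hι : w * ι = ι * w) (X : Finset (Equiv.Perm S)) :
    ι ∈ X.map (cjE w) ↔ ι ∈ X := by
  rw [Finset.mem_map]
  constructor
  · rintro ⟨t, ht, he⟩
    rw [cjE_apply] at he
    have : t = ι := by
      calc t = w⁻¹ * (w * t * w⁻¹) * w := by group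
        _ = w⁻¹ * ι * w := by rw [he]
        _ = w⁻¹ * (ι * w) := by group
        _ = w⁻¹ * (w * ι) := by rw [hι]
        _ = ι := by group
    rwa [← this]
  · intro h
    refine ⟨ι, h, ?_⟩
    rw [cjE_apply]
    calc w * ι * w⁻¹ = ι * w * w⁻¹ := by rw [hι]
      _ = ι := by group

/-- the block profile `(|Δ ∩ S_b|)_b` for a block map `blk : S → B` -/
def prof {B : Type*} [DecidableEq B] (blk : S → B) (Δ : Finset S) (b : B) : ℕ := (Δ.filter (fun x => blk x = b)).card

/-- a relabelling permuting the blocks by `σ` (`blk (w x) = σ (blk x)`) permutes the profile by `σ` -/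
theorem prof_transport {B : Type*} [DecidableEq B] (blk : S → B) (σ : Equiv.Perm B) (w : Equiv.Perm S)
    (hσ : ∀ x, blk (w x) = σ (blk x)) (Δ : Finset S) (b : B) : prof blk (smulF w Δ) (σ b) = prof blk Δ b := by
  unfold prof smulF
  rw [Finset.filter_map, Finset.card_map]
  congr 1
  ext x
  simp only [Finset.mem_filter, Function.comp, Equiv.coe_toEmbedding, hσ]
  exact and_congr Iff.rfl σ.injective.eq_iff

/-- `Φ` is a CM type for the involution `ι`: `S = Φ ⊔ ιΦ` -/
def IsCMType (ι : Equiv.Perm S) (Φ : Finset S) : Prop := Disjoint Φ (smulF ι Φ) ∧ ∀ x, x ∈ Φ ∨ x ∈ smulF ι Φ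

/-- for `ι` commuting with `w`: `wΦ` is a CM type iff `Φ` is -/
theorem isCMType_transport {w ι : Equiv.Perm S} (hι : w * ι = ι * w) (Φ : Finset S) :
    IsCMType ι (smulF w Φ) ↔ IsCMType ι Φ := by
  unfold IsCMType
  have e : smulF ι (smulF w Φ) = smulF w (smulF ι Φ) := by
    rw [← smulF_mul, ← smulF_mul, hι]
  rw [e]
  constructor
  · rintro ⟨hd, hc⟩
    refine ⟨?_, ?_⟩
    · rw [Finset.disjoint_left] at hd ⊢
      intro x hx hx'
      exact hd (Finset.mem_map_of_mem _ hx) (Finset.mem_map_of_mem _ hx')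
    · intro x
      rcases hc (w x) with h | h
      · left; rw [mem_smulF] at h; simpa using h
      · right; rw [mem_smulF] at h; simpa using h
  · rintro ⟨hd, hc⟩
    refine ⟨?_, ?_⟩
    · unfold smulF
      exact Finset.disjoint_map _ |>.2 hd
    · intro x
      rcases hc (w⁻¹ x) with h | h
      · left; rw [mem_smulF]; exact h
      · right; rw [mem_smulF]; exact h

end HodgeRepro0.P5S4Transport
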